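import Mathlib.FieldTheory.IsAlgClosed.AlgebraicClosure
import Literature.AnabelianGeometry.AbsoluteAnabelian.FreeProSigmaNonVacuity
import Literature.AnabelianGeometry.AbsoluteAnabelian.AbsTopILem45iModelProofs
import Literature.AnabelianGeometry.AbsoluteAnabelian.AbsTopIII.CcnTransgressionFreeGeom
import Literature.AnabelianGeometry.AbsoluteAnabelian.AbsTopIII.CurveModelProp14iiOfHeisenbergLaw
import Literature.AnabelianGeometry.AbsoluteAnabelian.AbsTopIII.Thm19bPresentationsProofs
import Literature.GroupTheory.ProfiniteSubquotients
import HarnessLib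

/-!
# [AbsTopIII] Prop. 1.4 (ii): the surface-presentation law (SP) carries THREE rows (F-0341, F-0338, F-0365), and is NOT vacuous

Mochizuki, *Topics in Absolute Anabelian Geometry III*, §1, Prop. 1.4 (ii), manuscript p. 31 (lit key
`paper:url-5493eb38cbb7`).  Companion to `CurveModelProp14iiOfHeisenbergLaw.lean`, whose law-closers
`CurveModel.prop_1_4_ii_of_centralImagesLaw` / `CurveModel.prop_1_4_ii_of_surfacePresentationLaw` derive the
model-relative named fact `CurveModel.Prop_1_4_ii` (FACT-LIST F-0341) at an ARBITRARY model from a law on the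
geometric fundamental group `Δ_{U_x}` of each presentation `(U_x ⊆ X, x)` in the scope of Prop. 1.4 (ii):
(HZ) `I_x = ⟨c⟩⁻` with `c ∈ Δ_{U_x}` having central images of every order in finite continuous quotients of
`Δ_{U_x}`; (SP) `Δ_{U_x}` free profinite on `a_i, b_i` (`i < g_X`) with `I_x = ⟨∏[a_i, b_i]⟩⁻`.
This PROOF-ONLY file (no definitions, no named facts) adds (§3, v2 addendum: Thm. 1.9 (b) at every
coherent Kummer model modulo F-0339 + F-0340 + (SP), `CoherentKummerModel.thm_1_9_b_of_surfacePresentationLaw`):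

* **§1 the package** (`CurveModel.prop_1_4_ii_rows_of_surfacePresentationLaw`): (SP) together with the
  ATOMIC row F-0340 (`Prop_1_4_i'`, "`Π_U ↠ Π_{U'}` with kernel generated by inertia") gives
  `Prop_1_4_ii ∧ Prop_1_4_ii_transgression ∧ Prop_1_4_ii_sync` (F-0341 ∧ F-0338 ∧ F-0365) at an arbitrary
  model: (SP) supplies the two structural inputs `I_x ≤ [Δ_{U_x}, Δ_{U_x}]⁻` and "`Δ_{U_x}` free profinite" of
  abc-iut-f-076's instance-class closers `prop_1_4_ii_transgression_of_prop_1_4_i'_of_isFreePro` /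
  `prop_1_4_ii_sync_of_prop_1_4_i'_of_isFreePro` (every cyclotome presentation lies in the scope of (ii)).
* **§2 NON-VACUITY** (`CurveModel.exists_model_surfacePresentationLaw`): for every `g ≥ 1` a model
  `M : CurveModel` over `ℚ̄` (`G_k = 1`, `Π = Δ`; `Π_{U_x} := F̂_{2g} = ⟨a_i, b_i⟩^`, ONE rational cusp `x`
  with `I_x = D_x := ⟨∏[a_i, b_i]⟩⁻`, `Π_X := F̂_{2g} / ⟨⟨∏[a_i, b_i]⟩⟩⁻` the profinite surface group,
  `res :=` the quotient map) with a presentation INSIDE the scope of (ii) — `X` proper of genus `g`, `x`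
  rational, `N = ⟨⟨I_x⟩⟩⁻` — and non-degenerate (`I_x ≠ 1`, `Δ_X ≠ 1`), at which (SP) and (HZ) BOTH hold,
  `Prop_1_4_i'` holds, and `Prop_1_4_ii ∧ Prop_1_4_ii_transgression ∧ Prop_1_4_ii_sync` follow THROUGH
  the package.  Same carrier as abc-iut's `CurveModel.exists_closedSurface_prop_1_4` / abc-iut-L4-t17's
  `CurveModel.exists_thm_1_9_b_closedSurface`, rebuilt because those `∃`-statements do not export the
  identification `I_x = ⟨∏[a_i, b_i]⟩⁻`.

HONEST LABEL: the laws are hypothesis BINDERS; the NV model is group-theoretic (profinite completion of the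
topological `π₁` over an algebraically closed base), not the étale `π₁` (not constructed in the tree); an
inhabited law is consistency evidence for the hypothesis set of the closers, not the printed theorem.
Nothing here bears on [IUTchIII] Cor. 3.12; typed ≠ proved.
-/

noncomputable section

open CategoryTheory Topology
open scoped Pointwise

universe u

namespace Literature.AnabelianGeometry.AbsoluteAnabelian.AbsTopIII

open Literature.IUT.HodgeTheaters (profiniteCompletion toCompletion)

/-! ### §1 The package: (SP) + F-0340 ⇒ F-0341 ∧ F-0338 ∧ F-0365 -/

/-- Topological closure commutes with the closed embedding `Δ ↪ Π`. [folklore] -/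
private theorem topologicalClosure_map_geomSubtype_pkg (E : FundamentalExtension.{u})
    (H : Subgroup E.geom) :
    (H.map E.geom.subtype).topologicalClosure = H.topologicalClosure.map E.geom.subtype := by
  apply SetLike.coe_injective
  rw [Subgroup.topologicalClosure_coe, Subgroup.coe_map, Subgroup.coe_map,
    Subgroup.topologicalClosure_coe, Subgroup.coe_subtype]
  exact E.isClosed_geom.isClosedEmbedding_subtypeVal.closure_image_eq _

/-- **(SP) + F-0340 ⇒ F-0341 ∧ F-0338 ∧ F-0365 at an arbitrary model.**  If at every presentation in the
scope of Prop. 1.4 (ii) `Δ_{U_x}` is free profinite on `a_i, b_i` (`i < g_X`) with `I_x = ⟨∏[a_i, b_i]⟩⁻`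
(law (SP), a hypothesis binder), and the model satisfies the named fact `Prop_1_4_i'` (F-0340, by name), then
`Prop_1_4_ii` (F-0341: `CurveModel.prop_1_4_ii_of_surfacePresentationLaw`), `Prop_1_4_ii_transgression`
(F-0338) and `Prop_1_4_ii_sync` (F-0365) all hold — the last two through abc-iut-f-076's instance-class
closers, whose structural inputs `I_x ≤ [Δ_{U_x}, Δ_{U_x}]⁻` (`∏[a_i, b_i]` is a product of commutators) and
"`Δ_{U_x}` free profinite" are read off (SP) at every cyclotome presentation.
[cite: MochizukiAbsTopIII2015, Prop 1.4 (ii) p.31] -/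
theorem CurveModel.prop_1_4_ii_rows_of_surfacePresentationLaw (M : CurveModel.{u})
    (hSP : ∀ (Ux X : M.Curve) (h : M.IsCofiniteOpen Ux X), M.IsScheme Ux → M.IsScheme X →
      M.IsProper X → ∀ x : (M.cusps Ux).Cusp, (M.cusps Ux).IsRational x →
        cuspidalKernel (M.res h) =
          (Subgroup.normalClosure ((M.cusps Ux).Icusp x : Set (M.ext Ux).arith)).topologicalClosure →
        ∃ gens : Fin (M.genus X + M.genus X) → (M.ext Ux).geom,
          IsFreeProOn (M.ext Ux).geom {p : ℕ | p.Prime} gens ∧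
          (M.cusps Ux).Icusp x =
            (Subgroup.zpowers ((((List.finRange (M.genus X)).map fun i =>
              gens (Fin.castAdd (M.genus X) i) * gens (Fin.natAdd (M.genus X) i) *
                (gens (Fin.castAdd (M.genus X) i))⁻¹ * (gens (Fin.natAdd (M.genus X) i))⁻¹).prod :
                  (M.ext Ux).geom) : (M.ext Ux).arith)).topologicalClosure)
    (h14 : M.Prop_1_4_i') :
    M.Prop_1_4_ii ∧ M.Prop_1_4_ii_transgression ∧ M.Prop_1_4_ii_sync := by
  have hS : ∀ p : ℕ, p.Prime → p ∈ {p : ℕ | p.Prime} := fun p hp => hp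
  -- (SP) at a cyclotome presentation: `I_x ≤ [Δ, Δ]⁻` and `Δ` free profinite
  have hI : ∀ (Ux X : M.Curve) (h : M.IsCofiniteOpen Ux X) (x : (M.cusps Ux).Cusp),
      M.IsCyclotomePresentation h x →
        (M.cusps Ux).Icusp x ≤ (⁅(M.ext Ux).geom, (M.ext Ux).geom⁆).topologicalClosure := by
    intro Ux X h x hp
    obtain ⟨gens, -, hIx⟩ :=
      hSP Ux X h hp.isScheme.1 hp.isScheme.2 hp.isProper x hp.isRational hp.kernel_eq
    have hgeom : (M.ext Ux).geom = (⊤ : Subgroup (M.ext Ux).geom).map (M.ext Ux).geom.subtype := by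
      rw [← MonoidHom.range_eq_map, Subgroup.range_subtype]
    rw [hIx, ← Subgroup.coe_subtype, ← MonoidHom.map_zpowers, topologicalClosure_map_geomSubtype_pkg]
    calc ((Subgroup.zpowers _).topologicalClosure).map (M.ext Ux).geom.subtype
        ≤ ((⁅(⊤ : Subgroup (M.ext Ux).geom), (⊤ : Subgroup (M.ext Ux).geom)⁆).topologicalClosure).map
            (M.ext Ux).geom.subtype :=
          Subgroup.map_mono (topologicalClosure_zpowers_surfaceRelator_le
            (fun i => gens (Fin.castAdd (M.genus X) i)) (fun i => gens (Fin.natAdd (M.genus X) i)))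
      _ = (⁅(M.ext Ux).geom, (M.ext Ux).geom⁆).topologicalClosure := by
          rw [← topologicalClosure_map_geomSubtype_pkg, Subgroup.map_commutator, ← hgeom]
  have hfree : ∀ (Ux X : M.Curve) (h : M.IsCofiniteOpen Ux X) (x : (M.cusps Ux).Cusp),
      M.IsCyclotomePresentation h x → IsFreePro (M.ext Ux).geom {p : ℕ | p.Prime} := by
    intro Ux X h x hp
    obtain ⟨gens, hP, -⟩ :=
      hSP Ux X h hp.isScheme.1 hp.isScheme.2 hp.isProper x hp.isRational hp.kernel_eq
    exact ⟨_, gens, hP⟩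
  exact ⟨M.prop_1_4_ii_of_surfacePresentationLaw hSP,
    M.prop_1_4_ii_transgression_of_prop_1_4_i'_of_isFreePro hS h14 hI hfree,
    M.prop_1_4_ii_sync_of_prop_1_4_i'_of_isFreePro hS h14 hI hfree⟩

/-! ### §2 Non-vacuity: both laws at a genuine hyperbolic (ii)-scope -/

/-- Over an algebraically closed field the absolute Galois group is trivial. [folklore] -/
private theorem subsingleton_absoluteGaloisGroup_law (k : Type) [Field k] [IsAlgClosed k] :
    Subsingleton (Field.absoluteGaloisGroup k) := by
  refine ⟨fun σ τ => AlgEquiv.ext fun y => ?_⟩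
  obtain ⟨a, rfl⟩ :=
    (IsAlgClosed.algebraMap_bijective_of_isIntegral (k := k) (K := AlgebraicClosure k)).2 y
  rw [AlgEquiv.commutes, AlgEquiv.commutes]

/-- For an extension whose Galois group is trivial, `Δ = Π`. [folklore] -/
private theorem geom_eq_top_of_subsingleton_law (E : FundamentalExtension.{0}) [Subsingleton E.gal] :
    E.geom = ⊤ := by
  rw [eq_top_iff]
  intro y _
  rw [FundamentalExtension.mem_geom]
  exact Subsingleton.elim _ _

/-- **NON-VACUITY of (SP) and (HZ) at a genuine hyperbolic scope.**  For every `g ≥ 1` there is a model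
`M : CurveModel` over `ℚ̄` (`G_k = 1`, `Π = Δ`; `Π_{U_x} := F̂_{2g}`, one rational cusp `x` with
`I_x = D_x := ⟨∏[a_i, b_i]⟩⁻`, `Π_X := F̂_{2g}/⟨⟨∏[a_i, b_i]⟩⟩⁻`, `res :=` the quotient map) with a
presentation `(U_x ⊆ X, x)` INSIDE the scope of Prop. 1.4 (ii) — `X` proper of genus `g`, `x` rational,
`N = ⟨⟨I_x⟩⟩⁻`, and non-degenerate: `I_x ≠ 1`, `Δ_X ≠ 1` — at which the surface-presentation law (SP)
and the Heisenberg law (HZ) BOTH hold (so the closers `prop_1_4_ii_of_surfacePresentationLaw` /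
`_of_centralImagesLaw` fire non-vacuously), the atomic row `Prop_1_4_i'` (F-0340) holds (`res` is the
quotient map, kernel `⟨⟨I_x⟩⟩⁻`), and `Prop_1_4_ii ∧ Prop_1_4_ii_transgression ∧ Prop_1_4_ii_sync`
(F-0341 ∧ F-0338 ∧ F-0365) follow THROUGH the package `prop_1_4_ii_rows_of_surfacePresentationLaw`.
HONEST LABEL: a group-theoretic model (profinite completion of the topological `π₁`), not the étale `π₁`.
[cite: MochizukiAbsTopIII2015, Prop 1.4 (ii) p.31] -/
theorem CurveModel.exists_model_surfacePresentationLaw (g : ℕ) (hg : 1 ≤ g) :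
    ∃ (M : CurveModel.{0}) (Ux X : M.Curve) (h : M.IsCofiniteOpen Ux X) (x : (M.cusps Ux).Cusp),
      M.IsScheme Ux ∧ M.IsScheme X ∧ M.IsProper X ∧ M.genus X = g ∧ (M.cusps Ux).IsRational x ∧
        cuspidalKernel (M.res h) =
          (Subgroup.normalClosure ((M.cusps Ux).Icusp x : Set (M.ext Ux).arith)).topologicalClosure ∧
        (M.cusps Ux).Icusp x ≠ ⊥ ∧ (M.ext X).geom ≠ ⊥ ∧
        (∀ (Ux X : M.Curve) (h : M.IsCofiniteOpen Ux X), M.IsScheme Ux → M.IsScheme X →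
          M.IsProper X → ∀ x : (M.cusps Ux).Cusp, (M.cusps Ux).IsRational x →
            cuspidalKernel (M.res h) =
              (Subgroup.normalClosure ((M.cusps Ux).Icusp x : Set (M.ext Ux).arith)).topologicalClosure →
            ∃ gens : Fin (M.genus X + M.genus X) → (M.ext Ux).geom,
              IsFreeProOn (M.ext Ux).geom {p : ℕ | p.Prime} gens ∧
              (M.cusps Ux).Icusp x =
                (Subgroup.zpowers ((((List.finRange (M.genus X)).map fun i =>
                  gens (Fin.castAdd (M.genus X) i) * gens (Fin.natAdd (M.genus X) i) *
                    (gens (Fin.castAdd (M.genus X) i))⁻¹ * (gens (Fin.natAdd (M.genus X) i))⁻¹).prod :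
                      (M.ext Ux).geom) : (M.ext Ux).arith)).topologicalClosure) ∧
        (∀ (Ux X : M.Curve) (h : M.IsCofiniteOpen Ux X), M.IsScheme Ux → M.IsScheme X →
          M.IsProper X → ∀ x : (M.cusps Ux).Cusp, (M.cusps Ux).IsRational x →
            cuspidalKernel (M.res h) =
              (Subgroup.normalClosure ((M.cusps Ux).Icusp x : Set (M.ext Ux).arith)).topologicalClosure →
            ∃ c : (M.ext Ux).geom,
              (M.cusps Ux).Icusp x = (Subgroup.zpowers (c : (M.ext Ux).arith)).topologicalClosure ∧
              ∀ m : ℕ, 0 < m → ∃ (K : Type) (_ : Group K) (_ : Finite K) (_ : TopologicalSpace K)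
                (_ : DiscreteTopology K) (ψ : (M.ext Ux).geom →* K),
                  Continuous ψ ∧ ψ c ∈ Subgroup.center K ∧ orderOf (ψ c) = m) ∧
        M.Prop_1_4_i' ∧ M.Prop_1_4_ii ∧ M.Prop_1_4_ii_transgression ∧ M.Prop_1_4_ii_sync := by
  classical
  haveI : Subsingleton (Field.absoluteGaloisGroup (AlgebraicClosure ℚ)) :=
    subsingleton_absoluteGaloisGroup_law _
  have hg0 : 0 < g := hg
  have hS : ∀ p : ℕ, p.Prime → p ∈ {p : ℕ | p.Prime} := fun p hp => hp
  -- the free profinite group on `a_i, b_i` and the surface relator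
  let P : ProfiniteGrp.{0} := profiniteCompletion (FreeGroup (Fin (g + g)))
  let gens : Fin (g + g) → P := fun i => toCompletion (FreeGroup (Fin (g + g))) (FreeGroup.of i)
  have hP : IsFreeProOn P {p : ℕ | p.Prime} gens := isFreeProOn_profiniteCompletion_freeGroup (g + g)
  let c : P := ((List.finRange g).map fun i => gens (Fin.castAdd g i) * gens (Fin.natAdd g i) *
    (gens (Fin.castAdd g i))⁻¹ * (gens (Fin.natAdd g i))⁻¹).prod
  let I : Subgroup P := (Subgroup.zpowers c).topologicalClosure
  let N : Subgroup P := (Subgroup.normalClosure (I : Set P)).topologicalClosure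
  have hIc : IsClosed (I : Set P) := Subgroup.isClosed_topologicalClosure _
  have hNc : IsClosed (N : Set P) := Subgroup.isClosed_topologicalClosure _
  haveI hNn : N.Normal := Subgroup.is_normal_topologicalClosure _
  haveI : TotallyDisconnectedSpace (P ⧸ N) :=
    Literature.GroupTheory.ProfiniteSubquotients.totallyDisconnectedSpace_quotient N hNc
  let Q : ProfiniteGrp.{0} := ProfiniteGrp.of (P ⧸ N)
  -- the two extensions over `G = G_{ℚ̄} = 1` and the quotient morphism
  let G : ProfiniteGrp.{0} := absoluteGaloisGrp (AlgebraicClosure ℚ)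
  let E₁ : FundamentalExtension.{0} :=
    { arith := P, gal := G, aug := 1, aug_surjective := fun _ => ⟨1, Subsingleton.elim _ _⟩ }
  let E₀ : FundamentalExtension.{0} :=
    { arith := Q, gal := G, aug := 1, aug_surjective := fun _ => ⟨1, Subsingleton.elim _ _⟩ }
  let π : P →ₜ* (P ⧸ N) :=
    { QuotientGroup.mk' N with continuous_toFun := QuotientGroup.continuous_mk }
  let q : E₁ ⟶ E₀ := ⟨π, ContinuousMonoidHom.id _, fun _ => Subsingleton.elim _ _⟩
  have hE₁ : E₁.geom = ⊤ := geom_eq_top_of_subsingleton_law E₁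
  have hE₀ : E₀.geom = ⊤ := geom_eq_top_of_subsingleton_law E₀
  -- cusps: one cusp of `U_x` with `D = I`; none on `X`
  let C₁ : E₁.CuspidalData :=
    { Cusp := PUnit
      Dcusp := fun _ => I
      Icusp := fun _ => I ⊓ E₁.geom
      Icusp_eq := fun _ => rfl
      isClosed_Dcusp := fun _ => hIc
      eq_of_conj := fun y z _ _ => Subsingleton.elim y z }
  let C₀ : E₀.CuspidalData :=
    { Cusp := PEmpty
      Dcusp := fun y => y.elim
      Icusp := fun y => y.elim
      Icusp_eq := fun y => y.elim
      isClosed_Dcusp := fun y => y.elim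
      eq_of_conj := fun y => y.elim }
  have hC₁ : ∀ y, C₁.Icusp y = I := fun y => by
    change I ⊓ E₁.geom = I
    rw [hE₁, inf_top_eq]
  have hrat : ∀ y, C₁.IsRational y := fun _ g' _ => ⟨1, I.one_mem, Subsingleton.elim _ _⟩
  -- the model: `Curve = {X, U_x}` (`false ↦ X`, `true ↦ U_x`)
  let M : CurveModel.{0} :=
    { Curve := ULift.{1} Bool
      base := fun _ => AlgebraicClosure ℚ
      ext := fun U => cond U.down E₁ E₀
      galIso := fun U => by
        rcases U with ⟨_ | _⟩ <;> exact Iso.refl _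
      cusps := fun U => by
        rcases U with ⟨_ | _⟩
        exacts [C₀, C₁]
      IsProper := fun U => U = ⟨false⟩
      IsScheme := fun _ => True
      genus := fun _ => g
      FunctionField := fun _ => AlgebraicClosure ℚ
      Point := fun _ => PEmpty
      decomp := fun _ y => y.elim
      IsNFCurve := fun _ => True
      IsNFPoint := fun _ y => y.elim
      IsNFRational := fun _ _ => True
      IsNFConstant := fun _ _ => True
      NFFunctionField := fun _ => AlgebraicClosure ℚ
      IsStrictlyBelyiType := fun _ => False
      IsCofiniteOpen := fun U U' => U = ⟨true⟩ ∧ U' = ⟨false⟩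
      res := fun {U U'} h => by
        obtain ⟨rfl, rfl⟩ := h
        exact q }
  -- `N = Ker(res) ∩ Δ = ⟨⟨I_x⟩⟩⁻` at the presentation
  have hker1 : cuspidalKernel q =
      (Subgroup.normalClosure (C₁.Icusp PUnit.unit : Set P)).topologicalClosure := by
    rw [hC₁]
    change q.arith.toMonoidHom.ker ⊓ E₁.geom = N
    rw [hE₁, inf_top_eq]
    exact QuotientGroup.ker_mk' N
  -- `Δ_{U_x} = Π_{U_x} = F̂_{2g}` as a topological group
  let e : P ≃ₜ* E₁.geom :=
    { toFun := fun p => ⟨p, by rw [hE₁]; exact Subgroup.mem_top p⟩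
      invFun := fun p => p.1
      left_inv := fun _ => rfl
      right_inv := fun _ => rfl
      map_mul' := fun _ _ => rfl
      continuous_toFun := continuous_id.subtype_mk fun p => by rw [hE₁]; exact Subgroup.mem_top p
      continuous_invFun := continuous_subtype_val }
  have hrel : ((((List.finRange g).map fun i =>
      e (gens (Fin.castAdd g i)) * e (gens (Fin.natAdd g i)) *
        (e (gens (Fin.castAdd g i)))⁻¹ * (e (gens (Fin.natAdd g i)))⁻¹).prod : E₁.geom) : P) = c := by
    rw [Subgroup.val_list_prod, List.map_map]
    rfl
  -- (SP) at `M`: the only presentation is `(U_x ⊆ X, x)`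
  have hSP : ∀ (Ux X : M.Curve) (h : M.IsCofiniteOpen Ux X), M.IsScheme Ux → M.IsScheme X →
      M.IsProper X → ∀ x : (M.cusps Ux).Cusp, (M.cusps Ux).IsRational x →
        cuspidalKernel (M.res h) =
          (Subgroup.normalClosure ((M.cusps Ux).Icusp x : Set (M.ext Ux).arith)).topologicalClosure →
        ∃ gens : Fin (M.genus X + M.genus X) → (M.ext Ux).geom,
          IsFreeProOn (M.ext Ux).geom {p : ℕ | p.Prime} gens ∧
          (M.cusps Ux).Icusp x =
            (Subgroup.zpowers ((((List.finRange (M.genus X)).map fun i =>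
              gens (Fin.castAdd (M.genus X) i) * gens (Fin.natAdd (M.genus X) i) *
                (gens (Fin.castAdd (M.genus X) i))⁻¹ * (gens (Fin.natAdd (M.genus X) i))⁻¹).prod :
                  (M.ext Ux).geom) : (M.ext Ux).arith)).topologicalClosure := by
    intro Ux X h _ _ _ y _ _
    obtain ⟨rfl, rfl⟩ := h
    change ∃ gens' : Fin (g + g) → E₁.geom, IsFreeProOn E₁.geom {p : ℕ | p.Prime} gens' ∧
      C₁.Icusp y = (Subgroup.zpowers ((((List.finRange g).map fun i =>
        gens' (Fin.castAdd g i) * gens' (Fin.natAdd g i) *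
          (gens' (Fin.castAdd g i))⁻¹ * (gens' (Fin.natAdd g i))⁻¹).prod : E₁.geom) : P)).topologicalClosure
    refine ⟨fun i => e (gens i), hP.of_continuousMulEquiv e, ?_⟩
    rw [hC₁, hrel]
  -- (HZ) at `M`, from (SP) (`genus = g ≥ 1`)
  have hHZ := M.centralImagesLaw_of_surfacePresentationLaw hSP (fun _ _ => hg0)
  -- `I_x ≠ 1`: `c` has an image of order `2`
  have hI1 : I ≠ ⊥ := by
    intro hbot
    obtain ⟨K, _, _, _, _, ψ, -, -, hord⟩ := hP.centralImages_surfaceRelator hS hg0 2 two_pos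
    have hc1 : c = 1 := by
      rw [← Subgroup.mem_bot, ← hbot]
      exact Subgroup.le_topologicalClosure _ (Subgroup.mem_zpowers c)
    have h1 : orderOf (ψ c) = 1 := by rw [hc1, map_one, orderOf_one]
    rw [h1] at hord
    exact absurd hord (by decide)
  -- `⟨⟨c_g⟩⟩⁻ ≠ F̂_{2g}`: the continuous character `a₀ ↦ 1 ∈ ℤ/2` kills `[P, P]⁻ ⊇ ⟨⟨c_g⟩⟩⁻` but not `a₀`
  have hNtop : N ≠ ⊤ := by
    intro htop
    have h01 : Fin.castAdd g (⟨0, hg0⟩ : Fin g) ≠ Fin.natAdd g ⟨0, hg0⟩ := by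
      intro h
      have := congrArg Fin.val h
      simp at this
      omega
    letI : TopologicalSpace (Multiplicative (ZMod 2)) := ⊥
    haveI : DiscreteTopology (Multiplicative (ZMod 2)) := ⟨rfl⟩
    obtain ⟨χ, hχc, hχa, -⟩ := hP.exists_continuous_hom_pair hS h01 (Multiplicative (ZMod 2))
      (Multiplicative.ofAdd 1) 1
    have hcl : IsClosed (χ.ker : Set P) := by
      rw [MonoidHom.coe_ker]
      exact (isClosed_discrete _).preimage hχc
    have hcomm : (⁅(⊤ : Subgroup P), (⊤ : Subgroup P)⁆).topologicalClosure ≤ χ.ker := by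
      refine Subgroup.topologicalClosure_minimal _ ?_ hcl
      rw [← commutator_def]
      exact Abelianization.commutator_subset_ker χ
    have hIle : I ≤ (⁅(⊤ : Subgroup P), (⊤ : Subgroup P)⁆).topologicalClosure :=
      topologicalClosure_zpowers_surfaceRelator_le _ _
    have hχN : N ≤ χ.ker :=
      Subgroup.topologicalClosure_minimal _ (Subgroup.normalClosure_le_normal (hIle.trans hcomm)) hcl
    have ha : gens (Fin.castAdd g ⟨0, hg0⟩) ∈ χ.ker := hχN (by rw [htop]; exact Subgroup.mem_top _)
    rw [MonoidHom.mem_ker, hχa] at ha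
    exact absurd ha (by decide)
  -- F-0340 at `M`: `res` is surjective with bijective Galois part and kernel `⟨⟨I_x⟩⟩⁻` (`S = {x}`)
  have h14i' : M.Prop_1_4_i' := by
    intro U U' h _ _
    obtain ⟨rfl, rfl⟩ := h
    change Function.Surjective π ∧ Function.Bijective (ContinuousMonoidHom.id G) ∧
      ∃ S : Set C₁.Cusp, π.toMonoidHom.ker =
        (Subgroup.normalClosure (⋃ c ∈ S, (C₁.Icusp c : Set P))).topologicalClosure
    refine ⟨QuotientGroup.mk'_surjective N, Function.bijective_id, Set.univ, ?_⟩
    have hU : (⋃ c ∈ (Set.univ : Set C₁.Cusp), (C₁.Icusp c : Set P)) = (I : Set P) := by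
      ext y
      simp only [Set.mem_iUnion, Set.mem_univ, hC₁, SetLike.mem_coe, exists_const]
    rw [hU]
    exact QuotientGroup.ker_mk' N
  refine ⟨M, ⟨true⟩, ⟨false⟩, ⟨rfl, rfl⟩, PUnit.unit, trivial, trivial, rfl, rfl, hrat PUnit.unit,
    hker1, ?_, ?_, hSP, hHZ, h14i', M.prop_1_4_ii_rows_of_surfacePresentationLaw hSP h14i'⟩
  · -- `I_x = I ≠ 1`
    change C₁.Icusp PUnit.unit ≠ ⊥
    rw [hC₁]
    exact hI1
  · -- `Δ_X = P / N ≠ 1` since `N ≠ P`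
    change E₀.geom ≠ ⊥
    rw [hE₀]
    intro htop
    apply hNtop
    rw [eq_top_iff]
    intro y _
    have hy : (QuotientGroup.mk y : P ⧸ N) = 1 :=
      (Subgroup.eq_bot_iff_forall _).mp htop _ (Subgroup.mem_top _)
    exact (QuotientGroup.eq_one_iff y).mp hy

/-! ### §3 (v2 addendum) Thm. 1.9 (b) at a coherent Kummer model, modulo F-0339 + F-0340 + law (SP) -/

/-- **[AbsTopIII] Thm. 1.9 (b) (`Thm_1_9_b`, FACT-LIST F-0346) at every coherent Kummer model from the two
ATOMIC Prop. 1.4 (i) rows and the surface-presentation law.**  abc-iut's `CoherentKummerModel.thm_1_9_b`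
derives the `D_z`-equivariant synchronizations `I_z ⥲ M_Z` from the four named facts `Prop_1_4_i` (F-0339),
`Prop_1_4_i'` (F-0340), `Prop_1_4_ii` (F-0341), `Prop_1_4_ii_transgression` (F-0338); the last two are
consequences of (SP) + F-0340 (`CurveModel.prop_1_4_ii_rows_of_surfacePresentationLaw`), so Thm. 1.9 (b)
holds at every coherent Kummer model modulo F-0339 + F-0340 + (SP) — two atomic interface laws ("`I_x ≅ Ẑ(1)`",
"`Π_U ↠ Π_{U'}` with kernel generated by inertia") and one classical structure law on `Δ_{U_x}`
([SGA1 XIII Cor. 2.12]).  Law = hypothesis binder. [cite: MochizukiAbsTopIII2015, Thm 1.9 (b) p.37] -/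
theorem CoherentKummerModel.thm_1_9_b_of_surfacePresentationLaw (M : CoherentKummerModel.{u})
    (h14i : M.Prop_1_4_i) (h14 : M.Prop_1_4_i')
    (hSP : ∀ (Ux X : M.Curve) (h : M.IsCofiniteOpen Ux X), M.IsScheme Ux → M.IsScheme X →
      M.IsProper X → ∀ x : (M.cusps Ux).Cusp, (M.cusps Ux).IsRational x →
        cuspidalKernel (M.res h) =
          (Subgroup.normalClosure ((M.cusps Ux).Icusp x : Set (M.ext Ux).arith)).topologicalClosure →
        ∃ gens : Fin (M.genus X + M.genus X) → (M.ext Ux).geom,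
          IsFreeProOn (M.ext Ux).geom {p : ℕ | p.Prime} gens ∧
          (M.cusps Ux).Icusp x =
            (Subgroup.zpowers ((((List.finRange (M.genus X)).map fun i =>
              gens (Fin.castAdd (M.genus X) i) * gens (Fin.natAdd (M.genus X) i) *
                (gens (Fin.castAdd (M.genus X) i))⁻¹ * (gens (Fin.natAdd (M.genus X) i))⁻¹).prod :
                  (M.ext Ux).geom) : (M.ext Ux).arith)).topologicalClosure) :
    M.Thm_1_9_b :=
  have hrows := M.prop_1_4_ii_rows_of_surfacePresentationLaw hSP h14
  M.thm_1_9_b h14i h14 hrows.1 hrows.2.1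

end Literature.AnabelianGeometry.AbsoluteAnabelian.AbsTopIII
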